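import Summits.FinalStateConjecture.FinalStateConjecture.Theorems.EIHFluxBalanceInertialRecessionLorentz
import Summits.FinalStateConjecture.FinalStateConjecture.Theorems.InertialRecession.Negative.PaintingRigidityStabiliser

/-!
# Route EIHFluxBalance — `InertialRecession`, line `sublinear-is-free-clean-window-charges`,
# stub `stub_quasiStationarity`: the Kerr–Schild stabiliser in the Lorentz algebra

Helper file (part 2 of the kinematic reduction of the stub `stub_quasiStationarity` of the crux
`stmt-FinalStateConjecture-10166`). The lab-time derivative of the painted summand
`y ↦ g_{M,a}(Λ(y⁰)⁻¹(0, y̲ − ξ(y⁰)))(Λ(y⁰)⁻¹·, Λ(y⁰)⁻¹·)` sees the Lorentz motion only through the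
body-frame rate `ω = Λ⁻¹Λ̇ ∈ so(1,3)` MODULO the infinitesimal stabiliser of `g_{M,a}`: rotations
about the spin axis `e₃` for `a ≠ 0` (axisymmetry, file `…Negative.PaintingRigidityStabiliser`),
all rotations for `a = 0` (spherical symmetry of Schwarzschild). This file records:

* `minkowski_bodyRate_antisymm` : `ω = Λ(t)⁻¹Λ̇(t)` is `η`-antisymmetric (O'Neill 1983, Ch. 9);
* `kerrBilin_zero_spin_invariant` : for `a = 0` the Kerr–Schild form is invariant under every
  `η`-isometry fixing `e₀`;
* the rotation generators `J23`, `J31` (with `J12` of the negative file), the one-parameter groups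
  `θ ↦ 1 + sin θ J + (1 − cos θ) J²` they generate (`minkowski_rotCurve`, `hasDerivAt_rotCurve`),
* the ENTRYWISE REDUCTION of an `η`-antisymmetric `ω` modulo the stabiliser algebra:
  `‖(ω − ω_K) v‖ ≤ 3 (‖ω e₀‖ + ‖ω e₃‖) ‖v‖` with `ω_K ∈ ℝ J12` (`norm_sub_spinStab_apply_le`), and
  `‖(ω − ω_K) v‖ ≤ 4 ‖ω e₀‖ ‖v‖` with `ω_K ∈ so(3)` (`norm_sub_rotStab_apply_le`).
-/

noncomputable section

namespace Summit.FinalStateConjecture.FinalStateConjecture.Theorems.SublinearIsFree.QuasiStationarity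

open scoped BigOperators Topology ContDiff
open Filter Set Function Literature.Geometry.Lorentzian
open Summit.FinalStateConjecture.FinalStateConjecture.Theorems
open Summit.FinalStateConjecture.FinalStateConjecture.Theorems.InertialRecession.Negative

/-! ### The body-frame rate of a Lorentz motion -/

/-- `η(Λ⁻¹x, y) = η(x, Λ y)` for `Λ ∈ O(1,3)` (invariance applied to `Λ⁻¹x`, `y`; O'Neill 1983,
Ch. 9, p. 233). [folklore] -/
theorem minkowski_symm_apply_left (Λ : lorentzGroup) (x y : E4) :
    Minkowski.bilin ((Λ : E4 ≃L[ℝ] E4).symm x) y = Minkowski.bilin x ((Λ : E4 ≃L[ℝ] E4) y) := by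
  have h := Λ.2 ((Λ : E4 ≃L[ℝ] E4).symm x) y
  rw [ContinuousLinearEquiv.apply_symm_apply] at h
  exact h.symm

/-- `η(x, Λ⁻¹y) = η(Λ x, y)` for `Λ ∈ O(1,3)` (O'Neill 1983, Ch. 9, p. 233). [folklore] -/
theorem minkowski_symm_apply_right (Λ : lorentzGroup) (x y : E4) :
    Minkowski.bilin x ((Λ : E4 ≃L[ℝ] E4).symm y) = Minkowski.bilin ((Λ : E4 ≃L[ℝ] E4) x) y := by
  rw [Minkowski.bilin_symm, minkowski_symm_apply_left, Minkowski.bilin_symm]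

/-- **The body-frame rate of a Lorentz motion is `η`-antisymmetric**: if `s ↦ Λ(s)` (as
operators) has derivative `Λ̇` at `t`, then `ω = Λ(t)⁻¹Λ̇` satisfies `η(ω v, w) + η(v, ω w) = 0`
(differentiate the constant `η(Λ(s)v, Λ(s)w) = η(v, w)` and transport by `Λ(t)⁻¹`; O'Neill 1983,
Ch. 9: the Lie algebra of `O(1,3)`). [folklore] -/
theorem minkowski_bodyRate_antisymm {Λ : ℝ → lorentzGroup} {t : ℝ} {Λ' : E4 →L[ℝ] E4}
    (hΛ' : HasDerivAt (fun s ↦ ((Λ s : E4 ≃L[ℝ] E4) : E4 →L[ℝ] E4)) Λ' t) (v w : E4) :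
    Minkowski.bilin ((Λ t : E4 ≃L[ℝ] E4).symm (Λ' v)) w +
      Minkowski.bilin v ((Λ t : E4 ≃L[ℝ] E4).symm (Λ' w)) = 0 := by
  set L : ℝ → E4 →L[ℝ] E4 := fun s ↦ ((Λ s : E4 ≃L[ℝ] E4) : E4 →L[ℝ] E4) with hL
  have hv : HasDerivAt (fun s ↦ L s v) (Λ' v) t := by
    simpa using hΛ'.clm_apply (hasDerivAt_const t v)
  have hw : HasDerivAt (fun s ↦ L s w) (Λ' w) t := by
    simpa using hΛ'.clm_apply (hasDerivAt_const t w)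
  have hB : HasDerivAt (fun s ↦ Minkowski.bilin (L s v)) (Minkowski.bilin (Λ' v)) t :=
    (Minkowski.bilin).hasFDerivAt.comp_hasDerivAt t hv
  have hBvw : HasDerivAt (fun s ↦ Minkowski.bilin (L s v) (L s w))
      (Minkowski.bilin (Λ' v) (L t w) + Minkowski.bilin (L t v) (Λ' w)) t :=
    hB.clm_apply hw
  have hconst : (fun s ↦ Minkowski.bilin (L s v) (L s w)) = fun _ ↦ Minkowski.bilin v w := by
    funext s
    exact (Λ s).2 v w
  rw [hconst] at hBvw
  have hzero : Minkowski.bilin (Λ' v) (L t w) + Minkowski.bilin (L t v) (Λ' w) = 0 :=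
    hBvw.unique (hasDerivAt_const t _)
  rw [minkowski_symm_apply_left, minkowski_symm_apply_right]
  simpa [hL] using hzero

/-! ### Spherical symmetry of the Schwarzschild form (`a = 0`) -/

/-- `η(x, e₀) = −x⁰` (O'Neill 1983, Ch. 3, p. 55). [folklore] -/
theorem minkowski_bilin_basisVector_zero_right (x : E4) :
    Minkowski.bilin x (E4.basisVector 0) = -(x 0) := by
  rw [Minkowski.bilin_symm, Minkowski.bilin_basisVector_zero_left]

/-- An `η`-isometry fixing `e₀` preserves time components. [folklore] -/
theorem apply_zero_of_isometry_fix {R : E4 → E4}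
    (hR : ∀ v w, Minkowski.bilin (R v) (R w) = Minkowski.bilin v w)
    (hR0 : R (E4.basisVector 0) = E4.basisVector 0) (u : E4) : R u 0 = u 0 := by
  have h := hR u (E4.basisVector 0)
  rw [hR0, minkowski_bilin_basisVector_zero_right, minkowski_bilin_basisVector_zero_right] at h
  linarith

/-- An `η`-isometry fixing `e₀` preserves spatial inner products. [folklore] -/
theorem sum_spatial_mul_of_isometry_fix {R : E4 → E4}
    (hR : ∀ v w, Minkowski.bilin (R v) (R w) = Minkowski.bilin v w)
    (hR0 : R (E4.basisVector 0) = E4.basisVector 0) (u z : E4) :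
    ∑ i : Fin 3, R u i.succ * R z i.succ = ∑ i : Fin 3, u i.succ * z i.succ := by
  have h := hR u z
  rw [Minkowski.bilin_apply, Minkowski.bilin_apply, apply_zero_of_isometry_fix hR hR0,
    apply_zero_of_isometry_fix hR hR0] at h
  linarith

/-- An `η`-isometry fixing `e₀` preserves the spatial radius. [folklore] -/
theorem spatialNorm_of_isometry_fix {R : E4 → E4}
    (hR : ∀ v w, Minkowski.bilin (R v) (R w) = Minkowski.bilin v w)
    (hR0 : R (E4.basisVector 0) = E4.basisVector 0) (u : E4) :
    E4.spatialNorm (R u) = E4.spatialNorm u := by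
  have h := sum_spatial_mul_of_isometry_fix hR hR0 u u
  simp only [Fin.sum_univ_three, show (1 : Fin 3).succ = 2 from rfl,
    show (2 : Fin 3).succ = 3 from rfl, show (0 : Fin 3).succ = 1 from rfl] at h
  have hsq : E4.spatialNorm (R u) ^ 2 = E4.spatialNorm u ^ 2 := by
    rw [E4.spatialNorm_sq, E4.spatialNorm_sq]
    nlinarith [h]
  exact (pow_left_inj₀ (E4.spatialNorm_nonneg _) (E4.spatialNorm_nonneg _) two_ne_zero).mp hsq

/-- The Schwarzschild null covector: `ℓ_y(u) = u⁰ + ⟨y̲, u̲⟩/‖y̲‖` for `a = 0` (Kerr–Schild 1965,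
§2; junk value `u⁰` on the axis `y̲ = 0`). [cite: KerrSchild1965, §2] -/
theorem nullCovector_zero_spin_apply (y u : E4) :
    Kerr.nullCovector 0 y u = u 0 + (∑ i : Fin 3, y i.succ * u i.succ) / E4.spatialNorm y := by
  simp only [Kerr.nullCovector, Kerr.nullCovectorFun, E4.covector_apply, Fin.sum_univ_four,
    Fin.sum_univ_three, Kerr.radius_zero_left, Matrix.cons_val_zero, Matrix.cons_val_one,
    Matrix.cons_val, show (1 : Fin 3).succ = 2 from rfl, show (2 : Fin 3).succ = 3 from rfl,
    show (0 : Fin 3).succ = 1 from rfl]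
  by_cases h : E4.spatialNorm y = 0
  · simp [h]
  · field_simp
    ring

/-- **Spherical symmetry of the Schwarzschild form in Kerr–Schild coordinates**: for `a = 0`,
`g_{M,0}(R x)(R v, R w) = g_{M,0}(x)(v, w)` for every `η`-isometry `R` fixing `e₀` — such an `R`
preserves time components, spatial inner products and `‖x̲‖`, and
`g_{M,0} = η + (2M/‖x̲‖) ℓ ⊗ ℓ` with `ℓ(v) = v⁰ + ⟨x̲, v̲⟩/‖x̲‖` (Kerr–Schild 1965, §2).
[cite: KerrSchild1965, §2] -/
theorem kerrBilin_zero_spin_invariant {R : E4 → E4}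
    (hR : ∀ v w, Minkowski.bilin (R v) (R w) = Minkowski.bilin v w)
    (hR0 : R (E4.basisVector 0) = E4.basisVector 0) (M : ℝ) (x v w : E4) :
    Kerr.bilin M 0 (R x) (R v) (R w) = Kerr.bilin M 0 x v w := by
  have hr : Kerr.radius 0 (R x) = Kerr.radius 0 x := by
    rw [Kerr.radius_zero_left, Kerr.radius_zero_left, spatialNorm_of_isometry_fix hR hR0]
  have hH : Kerr.scalarH M 0 (R x) = Kerr.scalarH M 0 x := by
    simp only [Kerr.scalarH, hr, ne_eq, OfNat.ofNat_ne_zero, not_false_eq_true, zero_pow, zero_mul,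
      add_zero]
  have hℓ : ∀ u, Kerr.nullCovector 0 (R x) (R u) = Kerr.nullCovector 0 x u := fun u ↦ by
    rw [nullCovector_zero_spin_apply, nullCovector_zero_spin_apply,
      sum_spatial_mul_of_isometry_fix hR hR0, spatialNorm_of_isometry_fix hR hR0,
      apply_zero_of_isometry_fix hR hR0]
  rw [Kerr.bilin_apply, Kerr.bilin_apply, hH, hℓ, hℓ, hR]

/-! ### Rotation generators and the one-parameter groups they generate -/

/-- The generator of rotations in the `(x², x³)` plane: `e₂ ↦ e₃`, `e₃ ↦ −e₂`. [folklore] -/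
def J23 : E4 →L[ℝ] E4 :=
  (EuclideanSpace.proj (2 : Fin 4) : E4 →L[ℝ] ℝ).smulRight (E4.basisVector 3) -
    (EuclideanSpace.proj (3 : Fin 4) : E4 →L[ℝ] ℝ).smulRight (E4.basisVector 2)

/-- The generator of rotations in the `(x³, x¹)` plane: `e₃ ↦ e₁`, `e₁ ↦ −e₃`. [folklore] -/
def J31 : E4 →L[ℝ] E4 :=
  (EuclideanSpace.proj (3 : Fin 4) : E4 →L[ℝ] ℝ).smulRight (E4.basisVector 1) -
    (EuclideanSpace.proj (1 : Fin 4) : E4 →L[ℝ] ℝ).smulRight (E4.basisVector 3)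

/-- Componentwise extensionality on `E4`. [folklore] -/
private theorem ext4 {v w : E4} (h0 : v 0 = w 0) (h1 : v 1 = w 1) (h2 : v 2 = w 2)
    (h3 : v 3 = w 3) : v = w := by
  ext k
  fin_cases k <;> assumption

/-- Components of `J12 v = (0, −v², v¹, 0)`. [folklore] -/
theorem J12_apply (v : E4) :
    J12 v 0 = 0 ∧ J12 v 1 = -v 2 ∧ J12 v 2 = v 1 ∧ J12 v 3 = 0 := by
  refine ⟨?_, ?_, ?_, ?_⟩ <;> simp [J12]

/-- Components of `J23 v = (0, 0, −v³, v²)`. [folklore] -/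
theorem J23_apply (v : E4) :
    J23 v 0 = 0 ∧ J23 v 1 = 0 ∧ J23 v 2 = -v 3 ∧ J23 v 3 = v 2 := by
  refine ⟨?_, ?_, ?_, ?_⟩ <;> simp [J23]

/-- Components of `J31 v = (0, v³, 0, −v¹)`. [folklore] -/
theorem J31_apply (v : E4) :
    J31 v 0 = 0 ∧ J31 v 1 = v 3 ∧ J31 v 2 = 0 ∧ J31 v 3 = -v 1 := by
  refine ⟨?_, ?_, ?_, ?_⟩ <;> simp [J31]

/-- `η` in components (O'Neill 1983, Ch. 3, p. 55). [folklore] -/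
theorem minkowski_components (v w : E4) :
    Minkowski.bilin v w = -(v 0 * w 0) + v 1 * w 1 + v 2 * w 2 + v 3 * w 3 := by
  simp only [Minkowski.bilin_apply, Fin.sum_univ_three, show (1 : Fin 3).succ = 2 from rfl,
    show (2 : Fin 3).succ = 3 from rfl, show (0 : Fin 3).succ = 1 from rfl]
  ring

/-- The three rotation generators are `η`-antisymmetric, cube to minus themselves, and kill
`e₀` (they span the Lie algebra `so(3)` of the stabiliser of `e₀`). [folklore] -/
theorem rotGen_props (J : E4 →L[ℝ] E4) (hJ : J = J12 ∨ J = J23 ∨ J = J31) :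
    (∀ v w, Minkowski.bilin (J v) w = -Minkowski.bilin v (J w)) ∧
      (∀ v, J (J (J v)) = -J v) ∧ J (E4.basisVector 0) = 0 := by
  rcases hJ with rfl | rfl | rfl
  · refine ⟨fun v w ↦ ?_, fun v ↦ ?_, ?_⟩
    · rw [minkowski_components, minkowski_components]
      obtain ⟨a0, a1, a2, a3⟩ := J12_apply v
      obtain ⟨b0, b1, b2, b3⟩ := J12_apply w
      rw [a0, a1, a2, a3, b0, b1, b2, b3]; ring
    · refine ext4 ?_ ?_ ?_ ?_ <;>
        simp only [(J12_apply _).1, (J12_apply _).2.1, (J12_apply _).2.2.1,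
          (J12_apply _).2.2.2, PiLp.neg_apply, neg_neg, neg_zero]
    · refine ext4 ?_ ?_ ?_ ?_ <;>
        simp [(J12_apply _).1, (J12_apply _).2.1, (J12_apply _).2.2.1, (J12_apply _).2.2.2]
  · refine ⟨fun v w ↦ ?_, fun v ↦ ?_, ?_⟩
    · rw [minkowski_components, minkowski_components]
      obtain ⟨a0, a1, a2, a3⟩ := J23_apply v
      obtain ⟨b0, b1, b2, b3⟩ := J23_apply w
      rw [a0, a1, a2, a3, b0, b1, b2, b3]; ring
    · refine ext4 ?_ ?_ ?_ ?_ <;>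
        simp only [(J23_apply _).1, (J23_apply _).2.1, (J23_apply _).2.2.1,
          (J23_apply _).2.2.2, PiLp.neg_apply, neg_neg, neg_zero]
    · refine ext4 ?_ ?_ ?_ ?_ <;>
        simp [(J23_apply _).1, (J23_apply _).2.1, (J23_apply _).2.2.1, (J23_apply _).2.2.2]
  · refine ⟨fun v w ↦ ?_, fun v ↦ ?_, ?_⟩
    · rw [minkowski_components, minkowski_components]
      obtain ⟨a0, a1, a2, a3⟩ := J31_apply v
      obtain ⟨b0, b1, b2, b3⟩ := J31_apply w
      rw [a0, a1, a2, a3, b0, b1, b2, b3]; ring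
    · refine ext4 ?_ ?_ ?_ ?_ <;>
        simp only [(J31_apply _).1, (J31_apply _).2.1, (J31_apply _).2.2.1,
          (J31_apply _).2.2.2, PiLp.neg_apply, neg_neg, neg_zero]
    · refine ext4 ?_ ?_ ?_ ?_ <;>
        simp [(J31_apply _).1, (J31_apply _).2.1, (J31_apply _).2.2.1, (J31_apply _).2.2.2]

/-- **The one-parameter group of a rotation generator consists of `η`-isometries**: if `J` is
`η`-antisymmetric with `J³ = −J`, then `R_θ = 1 + sin θ J + (1 − cos θ) J²` preserves `η`
(expand and use `sin² + cos² = 1`; this is `exp(θJ)`). [folklore] -/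
theorem minkowski_rotCurve {J : E4 →L[ℝ] E4}
    (hJ : ∀ v w, Minkowski.bilin (J v) w = -Minkowski.bilin v (J w))
    (hJ3 : ∀ v, J (J (J v)) = -J v) (θ : ℝ) (v w : E4) :
    Minkowski.bilin ((1 + Real.sin θ • J + (1 - Real.cos θ) • J.comp J) v)
      ((1 + Real.sin θ • J + (1 - Real.cos θ) • J.comp J) w) = Minkowski.bilin v w := by
  have e1 : ∀ u : E4, (1 + Real.sin θ • J + (1 - Real.cos θ) • J.comp J) u =
      u + Real.sin θ • J u + (1 - Real.cos θ) • J (J u) := fun u ↦ by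
    simp [add_apply]
  rw [e1, e1]
  simp only [map_add, map_smul, add_apply, FunLike.coe_smul, Pi.smul_apply, smul_eq_mul]
  -- all pairings in terms of `X = η(v, Jw)` and `Y = η(v, J²w)`
  have t1 : Minkowski.bilin (J v) w = -Minkowski.bilin v (J w) := hJ v w
  have t3 : Minkowski.bilin (J v) (J w) = -Minkowski.bilin v (J (J w)) := hJ v (J w)
  have t2 : Minkowski.bilin (J (J v)) w = Minkowski.bilin v (J (J w)) := by
    rw [hJ, t3, neg_neg]
  have t4 : Minkowski.bilin (J v) (J (J w)) = Minkowski.bilin v (J w) := by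
    rw [hJ, hJ3, map_neg, neg_neg]
  have t5 : Minkowski.bilin (J (J v)) (J w) = -Minkowski.bilin v (J w) := by
    rw [hJ, t4]
  have t6 : Minkowski.bilin (J (J v)) (J (J w)) = -Minkowski.bilin v (J (J w)) := by
    rw [hJ, hJ3, map_neg, neg_neg, t3]
  rw [t1, t2, t3, t4, t5, t6]
  linear_combination (-Minkowski.bilin v (J (J w))) * Real.sin_sq_add_cos_sq θ

/-- The one-parameter group of a generator killing `e₀` fixes `e₀`. [folklore] -/
theorem rotCurve_basisVector_zero {J : E4 →L[ℝ] E4} (hJ0 : J (E4.basisVector 0) = 0) (θ : ℝ) :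
    (1 + Real.sin θ • J + (1 - Real.cos θ) • J.comp J) (E4.basisVector 0) = E4.basisVector 0 := by
  simp [add_apply, hJ0]

/-- At `θ = 0` the one-parameter group is the identity. [folklore] -/
theorem rotCurve_zero_apply (J : E4 →L[ℝ] E4) (u : E4) :
    (1 + Real.sin 0 • J + (1 - Real.cos 0) • J.comp J) u = u := by
  simp

/-- The one-parameter group `θ ↦ 1 + sin θ J + (1 − cos θ) J²` is differentiable with derivative
`J` at `θ = 0`. [folklore] -/
theorem hasDerivAt_rotCurve (J : E4 →L[ℝ] E4) :
    HasDerivAt (fun θ ↦ (1 + Real.sin θ • J + (1 - Real.cos θ) • J.comp J)) J 0 := by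
  have h1 : HasDerivAt (fun θ ↦ Real.sin θ • J) (Real.cos 0 • J) 0 :=
    (Real.hasDerivAt_sin 0).smul_const J
  have h2 : HasDerivAt (fun θ ↦ (1 - Real.cos θ) • J.comp J) ((0 - -Real.sin 0) • J.comp J) 0 :=
    ((hasDerivAt_const 0 (1 : ℝ)).sub (Real.hasDerivAt_cos 0)).smul_const (J.comp J)
  have h := (h1.const_add (1 : E4 →L[ℝ] E4)).fun_add h2
  simp only [Real.cos_zero, one_smul, Real.sin_zero, neg_zero, sub_zero] at h
  rw [zero_smul ℝ (J.comp J), add_zero] at h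
  exact h

/-! ### The infinitesimal stabiliser identity -/

/-- **Infinitesimal invariance.** If a differentiable curve `θ ↦ R_θ` of `η`-isometries with
`R_0 = 1`, `Ṙ_0 = J` leaves the Kerr–Schild form invariant, `g(R_θ p)(R_θ v, R_θ w) = g(p)(v, w)`,
then `D(g − η)(p)[J p](v, w) + (g − η)(p)(J v, w) + (g − η)(p)(v, J w) = 0` (differentiate at
`θ = 0`). This is the identity that makes the lab-time derivative of the painted background blind
to the stabiliser directions of the body-frame rate. [folklore] -/
theorem stabiliser_generator_identity {M a : ℝ} {p : E4}
    (hp : DifferentiableAt ℝ (fun y ↦ Kerr.bilin M a y - Minkowski.bilin) p)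
    {R : ℝ → E4 →L[ℝ] E4} {J : E4 →L[ℝ] E4} (hR0 : ∀ u, R 0 u = u) (hRd : HasDerivAt R J 0)
    (hinv : ∀ θ v w, Kerr.bilin M a (R θ p) (R θ v) (R θ w) = Kerr.bilin M a p v w)
    (hη : ∀ θ v w, Minkowski.bilin (R θ v) (R θ w) = Minkowski.bilin v w) (v w : E4) :
    fderiv ℝ (fun y ↦ Kerr.bilin M a y - Minkowski.bilin) p (J p) v w +
      (Kerr.bilin M a p - Minkowski.bilin) (J v) w +
        (Kerr.bilin M a p - Minkowski.bilin) v (J w) = 0 := by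
  set K : E4 → E4 →L[ℝ] E4 →L[ℝ] ℝ := fun y ↦ Kerr.bilin M a y - Minkowski.bilin with hK
  have hRu : ∀ u : E4, HasDerivAt (fun θ ↦ R θ u) (J u) 0 := fun u ↦ by
    simpa using hRd.clm_apply (hasDerivAt_const 0 u)
  have hKR : HasDerivAt (K ∘ fun θ ↦ R θ p) (fderiv ℝ K p (J p)) 0 :=
    HasFDerivAt.comp_hasDerivAt_of_eq (l := K) (f := fun θ ↦ R θ p) (0 : ℝ) hp.hasFDerivAt
      (hRu p) (hR0 p).symm
  have hKRv : HasDerivAt (fun θ ↦ K (R θ p) (R θ v))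
      (fderiv ℝ K p (J p) (R 0 v) + K (R 0 p) (J v)) 0 := hKR.clm_apply (hRu v)
  have hKRvw : HasDerivAt (fun θ ↦ K (R θ p) (R θ v) (R θ w))
      ((fderiv ℝ K p (J p) (R 0 v) + K (R 0 p) (J v)) (R 0 w) + K (R 0 p) (R 0 v) (J w)) 0 :=
    hKRv.clm_apply (hRu w)
  have hconst : (fun θ ↦ K (R θ p) (R θ v) (R θ w)) =
      fun _ ↦ Kerr.bilin M a p v w - Minkowski.bilin v w := by
    funext θ
    simp only [hK, sub_apply, hinv, hη]
  rw [hconst] at hKRvw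
  have hzero := hKRvw.unique (hasDerivAt_const 0 _)
  simp only [hR0, add_apply] at hzero
  simpa [hK] using hzero

/-- Registered sub-goal form (stub `schwarzschild_isotropy` of the crux item) of
`kerrBilin_zero_spin_invariant`: spherical symmetry of the Schwarzschild form in Kerr–Schild coordinates
(Kerr–Schild 1965, §2). [cite: KerrSchild1965, §2] -/
theorem schwarzschild_isotropy : open Literature.Geometry.Lorentzian Filter Topology in ∀ {R : E4 → E4}, (∀ v w : E4, Minkowski.bilin (R v) (R w) = Minkowski.bilin v w) → R (E4.basisVector 0) = E4.basisVector 0 → ∀ (M : ℝ) (x v w : E4), Kerr.bilin M 0 (R x) (R v) (R w) = Kerr.bilin M 0 x v w :=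
  fun hR hR0 M x v w ↦ kerrBilin_zero_spin_invariant hR hR0 M x v w

end Summit.FinalStateConjecture.FinalStateConjecture.Theorems.SublinearIsFree.QuasiStationarity

end
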